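import Literature.NumberTheory.EllipticCurves.HeegnerPointsKolyvaginProp81InertiaProofs
import Literature.NumberTheory.EllipticCurves.BigRepModuleShapiroSelmerConditionsProofs
import Literature.NumberTheory.EllipticCurves.GreenbergSelmer
import Literature.NumberTheory.GaloisRepresentations.DecompositionGroupOfCompletion
import Literature.NumberTheory.GaloisRepresentations.IntegralGaloisActionProofs
import Literature.NumberTheory.Automorphic.GaloisActionPlaces
import Summits.BirchSwinnertonDyer.Rank1Residual.X11b.BDPRouteLocalKernelInertia
import HarnessLib

/-!
# Crux `PrintCf2.SplitBadTwoRankOneOfFacts` (stmt-BirchSwinnertonDyer-20368), road α v10.3 — brick (CT-𝔖), file 2: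
# A LIFT `τ` OF `c ∈ Aut(K/ℚ)` TO `K̄` MOVES DECOMPOSITION GROUPS: `τ⁻¹ D_{𝔓₀(u)} τ ≤ t · D_{𝔓₀(c⁻¹ u)} · t⁻¹`

Cell `bsd-print-cf2`, width seat `bsd-line-cf2-p1-w2` g10 (prover-bsd-line-cf2-p1-w2-g10-0); `--supports
stmt-BirchSwinnertonDyer-20368` (helper, Theses-free). HONEST FRAMING: nothing here closes a crux or a stub; BSD is not
proved by any of this; no summit statement is proved by this seat. THEOREMS ONLY (no definition, no named fact, no
`sorry`, no instance).

CONTENT (the Galois-theoretic half of the conjugation transport of Agboola's restricted Selmer groups; file 1 =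
`…RestrictedSelmerConjTransport` is the cohomological half). `K` a number field, `c ∈ Aut(K/ℚ)`, `τ` a ring automorphism
of `K̄` lifting `c` (`IsLiftOfAut c τ`), `T : \bar ℤ_K →+* \bar ℤ_K` a ring endomorphism of the absolute integers agreeing
with `τ` (`(T y : K̄) = τ y`; for `τ = e h e⁻¹` the transport of `h ∈ Γ_ℚ` such a `T` exists,
`exists_ringHom_coe_eq_absGaloisTransport`, by the tree's `InertiaLift.coe_transportIntegers`). Then:
* §1 `conjGalCMH_mem_decompositionSubgroup_comap` — **`τ⁻¹ D_𝔔 τ ≤ D_{T⁻¹𝔔}`** for every ideal `𝔔` of `\bar ℤ_K`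
  (`IsLiftOfAut.conjGalCMH σ = τ⁻¹στ`; on `\bar ℤ_K`, `T((τ⁻¹σ⁻¹τ)·y) = σ⁻¹·(T y)`);
* §2 `map_algebraMap_eq_algebraMap_smul` (`T|_{𝓞 K} = c`), `under_comap_eq_inv_smul` — **`T⁻¹𝔔 ∩ 𝓞 K = c⁻¹ · (𝔔 ∩ 𝓞 K)`**,
  `comap_adicCompletionPrime_mem_primesAbove` — `T⁻¹ 𝔓₀(u)` is a prime of `\bar ℤ_K` above the place `c⁻¹ · u`
  (the tree's action of `Aut(K/ℚ)` on `HeightOneSpectrum (𝓞 K)`, `Literature.NumberTheory.Automorphic`);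
* §3 (`GreenbergSelmer.decomp u = D_{𝔓₀(u)}`: x11b's `AcSelmer.decomp_eq_decompositionSubgroup_adicCompletionPrime`) the PLACE CLAUSE
  **`exists_conjGalCMH_decomp_mem_conj_decomp`: `∃ t ∈ Γ_K, τ⁻¹ D_u τ ≤ t D_{c⁻¹u} t⁻¹`** (transitivity of `Γ_K` on the primes
  above `c⁻¹u`, `exists_smul_eq_of_mem_primesAbove_holds`, and `D_{t·𝔓} = t D_𝔓 t⁻¹`, `Ideal.decompositionSubgroup_smul`), with
  `natCast_mem_inv_smul_iff` (`p ∈ c⁻¹u ↔ p ∈ u`); the infinite-place clause `exists_conjGalCMH_decompInf_mem` for totally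
  complex `K` (`decompInf w = ⊥`, tree `BigGaloisRep.decompInf_eq_bot_of_isComplex`);
* §4 `exists_ringHom_coe_eq_absGaloisTransport` (+ the inverse transport).
These are exactly the hypotheses `hfin`/`hstrict`/`hinf` of file 1's `resH1Hom_mem_restrictedSelmerBase` for the pair
`(τ⁻¹·τ, τ|_M)`; file 3 instantiates them on the S3c frame (`K = ℚ(√−7)`, `c` complex conjugation, `c·v̄ = v`).

References: J. Neukirch, *Algebraic Number Theory* (1999) I §9 (9.1)–(9.6), II §9 (9.6) [NeukirchANT1999];
J. W. S. Cassels, A. Fröhlich, *Algebraic Number Theory* (1967) VII §1 Prop. 1.2 [CasselsFrohlichANT1967];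
J.-P. Serre, *Galois Cohomology* II §1.1.
-/

noncomputable section

open scoped Classical Pointwise

set_option linter.dupNamespace false
set_option autoImplicit false

namespace Summit.BirchSwinnertonDyer.BirchSwinnertonDyer.Theorems.PrintCf2.ConjTransport

open Literature.NumberTheory.EllipticCurves Literature.NumberTheory.EllipticCurves.GreenbergSelmer
open Literature.NumberTheory.GaloisRepresentations Literature.NumberTheory.Automorphic Field NumberField IsDedekindDomain

variable {K : Type} [Field K] [NumberField K]

/-! ## §1 `τ⁻¹ D_𝔔 τ ≤ D_{T⁻¹ 𝔔}` -/

section Decomposition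

variable {c : K ≃ₐ[ℚ] K} {τ : AlgebraicClosure K ≃+* AlgebraicClosure K}

/-- The conjugate `τ⁻¹ g τ` (`IsLiftOfAut.conjGalCMH`) acts on `K̄` by `x ↦ τ⁻¹ (g (τ x))`. [folklore] -/
theorem conjGalCMH_smul (ht : IsLiftOfAut c τ) (g : absoluteGaloisGroup K) (x : AlgebraicClosure K) :
    ht.conjGalCMH g • x = τ.symm (g • τ x) := rfl

/-- **On `\bar ℤ_K`: `T ((τ⁻¹ g τ) · y) = g · (T y)`** for a ring endomorphism `T` of `\bar ℤ_K` agreeing with `τ` on `K̄`.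
[folklore] -/
theorem map_conjGalCMH_smul (ht : IsLiftOfAut c τ) (T : absIntegers (𝓞 K) K →+* absIntegers (𝓞 K) K)
    (hT : ∀ y : absIntegers (𝓞 K) K, ((T y : absIntegers (𝓞 K) K) : AlgebraicClosure K) = τ y)
    (g : absoluteGaloisGroup K) (y : absIntegers (𝓞 K) K) :
    T (ht.conjGalCMH g • y) = g • T y := by
  apply Subtype.ext
  rw [hT, integralClosure.coe_smul, conjGalCMH_smul, RingEquiv.apply_symm_apply, integralClosure.coe_smul, hT]

/-- **`τ⁻¹ D_𝔔 τ ≤ D_{T⁻¹𝔔}`**: if `σ` stabilises the ideal `𝔔` of `\bar ℤ_K` then `τ⁻¹στ` stabilises `T⁻¹𝔔 = 𝔔.comap T`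
(`y ∈ (τ⁻¹στ)·T⁻¹𝔔 ⟺ T((τ⁻¹σ⁻¹τ)·y) = σ⁻¹·Ty ∈ 𝔔 ⟺ Ty ∈ σ·𝔔 = 𝔔`). [cite: NeukirchANT1999, Ch. I §9 (9.1)–(9.6)] -/
theorem conjGalCMH_mem_decompositionSubgroup_comap (ht : IsLiftOfAut c τ)
    (T : absIntegers (𝓞 K) K →+* absIntegers (𝓞 K) K)
    (hT : ∀ y : absIntegers (𝓞 K) K, ((T y : absIntegers (𝓞 K) K) : AlgebraicClosure K) = τ y)
    (𝔔 : Ideal (absIntegers (𝓞 K) K)) {σ : absoluteGaloisGroup K}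
    (hσ : σ ∈ 𝔔.decompositionSubgroup (absoluteGaloisGroup K)) :
    ht.conjGalCMH σ ∈ (𝔔.comap T).decompositionSubgroup (absoluteGaloisGroup K) := by
  rw [Ideal.mem_decompositionSubgroup_iff] at hσ ⊢
  ext y
  rw [Ideal.mem_pointwise_smul_iff_inv_smul_mem, Ideal.mem_comap, Ideal.mem_comap, ← map_inv,
    map_conjGalCMH_smul ht T hT, ← Ideal.mem_pointwise_smul_iff_inv_smul_mem, hσ]

end Decomposition

/-! ## §2 `T|_{𝓞 K} = c`, hence `T⁻¹𝔔 ∩ 𝓞 K = c⁻¹ · (𝔔 ∩ 𝓞 K)` -/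

section Under

variable {c : K ≃ₐ[ℚ] K} {τ : AlgebraicClosure K ≃+* AlgebraicClosure K}

omit [NumberField K] in
/-- The structure map `𝓞 K → \bar ℤ_K → K̄` is `𝓞 K → K → K̄`. [folklore] -/
theorem coe_algebraMap_absIntegers (y : 𝓞 K) :
    ((algebraMap (𝓞 K) (absIntegers (𝓞 K) K) y : absIntegers (𝓞 K) K) : AlgebraicClosure K) =
      algebraMap K (AlgebraicClosure K) (y : K) := by
  rw [Subalgebra.coe_algebraMap]
  exact IsScalarTower.algebraMap_apply (𝓞 K) K (AlgebraicClosure K) y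

/-- **`T|_{𝓞 K} = c`**: a ring endomorphism of `\bar ℤ_K` agreeing with a lift `τ` of `c` maps `y ∈ 𝓞 K` to `c · y`.
[folklore] -/
theorem map_algebraMap_eq_algebraMap_smul (ht : IsLiftOfAut c τ) (T : absIntegers (𝓞 K) K →+* absIntegers (𝓞 K) K)
    (hT : ∀ y : absIntegers (𝓞 K) K, ((T y : absIntegers (𝓞 K) K) : AlgebraicClosure K) = τ y) (y : 𝓞 K) :
    T (algebraMap (𝓞 K) (absIntegers (𝓞 K) K) y) = algebraMap (𝓞 K) (absIntegers (𝓞 K) K) (c • y) := by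
  apply Subtype.ext
  rw [hT, coe_algebraMap_absIntegers, coe_algebraMap_absIntegers, ht, RingOfIntegers.coe_algEquiv_smul]

/-- **`T⁻¹𝔔 ∩ 𝓞 K = c⁻¹ · (𝔔 ∩ 𝓞 K)`** for every ideal `𝔔` of `\bar ℤ_K`. [cite: NeukirchANT1999, Ch. I §9 (9.1)] -/
theorem under_comap_eq_inv_smul (ht : IsLiftOfAut c τ) (T : absIntegers (𝓞 K) K →+* absIntegers (𝓞 K) K)
    (hT : ∀ y : absIntegers (𝓞 K) K, ((T y : absIntegers (𝓞 K) K) : AlgebraicClosure K) = τ y)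
    (𝔔 : Ideal (absIntegers (𝓞 K) K)) :
    (𝔔.comap T).under (𝓞 K) = c⁻¹ • 𝔔.under (𝓞 K) := by
  ext y
  rw [Ideal.under_def, Ideal.mem_comap, Ideal.mem_comap, map_algebraMap_eq_algebraMap_smul ht T hT,
    Ideal.mem_inv_pointwise_smul_iff, Ideal.under_def, Ideal.mem_comap]

/-- The prime of `c⁻¹ · u` is `c⁻¹ · u` (the tree's action of `Aut(K/ℚ)` on the finite places). [folklore] -/
theorem inv_smul_asIdeal (u : HeightOneSpectrum (𝓞 K)) : (c⁻¹ • u).asIdeal = c⁻¹ • u.asIdeal := rfl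

/-- **`p ∈ c⁻¹ · u ↔ p ∈ u`** (a natural number is fixed by `c`). [folklore] -/
theorem natCast_mem_inv_smul_asIdeal_iff (p : ℕ) (u : HeightOneSpectrum (𝓞 K)) :
    ((p : ℕ) : 𝓞 K) ∈ (c⁻¹ • u).asIdeal ↔ ((p : ℕ) : 𝓞 K) ∈ u.asIdeal := by
  have hp : c • ((p : ℕ) : 𝓞 K) = ((p : ℕ) : 𝓞 K) := map_natCast (MulSemiringAction.toRingHom (K ≃ₐ[ℚ] K) (𝓞 K) c) p
  rw [inv_smul_asIdeal, Ideal.mem_inv_pointwise_smul_iff, hp]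

/-- **`T⁻¹ 𝔓₀(u)` is a prime of `\bar ℤ_K` above the place `c⁻¹ · u`** (`𝔓₀(u) = adicCompletionPrime K u`, the prime cut out
by the chosen embedding `K̄ → \bar K_u`). [cite: NeukirchANT1999, Ch. I §9 (9.1)] -/
theorem comap_adicCompletionPrime_mem_primesAbove (ht : IsLiftOfAut c τ)
    (T : absIntegers (𝓞 K) K →+* absIntegers (𝓞 K) K)
    (hT : ∀ y : absIntegers (𝓞 K) K, ((T y : absIntegers (𝓞 K) K) : AlgebraicClosure K) = τ y)
    (u : HeightOneSpectrum (𝓞 K)) :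
    (adicCompletionPrime K u).comap T ∈ (c⁻¹ • u).primesAbove := by
  refine ⟨Ideal.IsPrime.comap T, ⟨?_⟩⟩
  rw [under_comap_eq_inv_smul ht T hT, under_adicCompletionPrime]
  rfl

end Under

/-! ## §3 The place clauses: `τ⁻¹ D_u τ ≤ t D_{c⁻¹u} t⁻¹`, and the infinite places -/

section Places

variable {c : K ≃ₐ[ℚ] K} {τ : AlgebraicClosure K ≃+* AlgebraicClosure K}

/-- **THE PLACE CLAUSE.** For a lift `τ` of `c ∈ Aut(K/ℚ)` admitting a compatible ring endomorphism `T` of `\bar ℤ_K`, and every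
finite place `u`: for some `t ∈ Γ_K`, **`τ⁻¹ D_u τ ≤ t · D_{c⁻¹u} · t⁻¹`** — `τ⁻¹ D_{𝔓₀(u)} τ ≤ D_{T⁻¹𝔓₀(u)}` (§1), `T⁻¹𝔓₀(u)`
lies above `c⁻¹u` (§2), so `T⁻¹𝔓₀(u) = t · 𝔓₀(c⁻¹u)` for some `t` (transitivity of `Γ_K` on the primes above a place,
`exists_smul_eq_of_mem_primesAbove_holds`) and `D_{t·𝔓} = t D_𝔓 t⁻¹` (`Ideal.decompositionSubgroup_smul`).
[cite: NeukirchANT1999, Ch. I §9 Prop. (9.1), Ch. II §9 Prop. (9.6)] [cite: CasselsFrohlichANT1967, Ch. VII §1 Prop. 1.2] -/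
theorem exists_conjGalCMH_decomp_mem_conj_decomp (ht : IsLiftOfAut c τ)
    (T : absIntegers (𝓞 K) K →+* absIntegers (𝓞 K) K)
    (hT : ∀ y : absIntegers (𝓞 K) K, ((T y : absIntegers (𝓞 K) K) : AlgebraicClosure K) = τ y)
    (u : HeightOneSpectrum (𝓞 K)) :
    ∃ t : absoluteGaloisGroup K, ∀ σ ∈ decomp u, ht.conjGalCMH σ ∈ MulAut.conj t • decomp (c⁻¹ • u) := by
  obtain ⟨t, ht'⟩ := HeightOneSpectrum.exists_smul_eq_of_mem_primesAbove_holds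
    (adicCompletionPrime_mem_primesAbove K (c⁻¹ • u)) (comap_adicCompletionPrime_mem_primesAbove ht T hT u)
  refine ⟨t, fun σ hσ ↦ ?_⟩
  rw [Summit.BirchSwinnertonDyer.Rank1Residual.X11b.AcSelmer.decomp_eq_decompositionSubgroup_adicCompletionPrime] at hσ ⊢
  rw [← Ideal.decompositionSubgroup_smul, ht']
  exact conjGalCMH_mem_decompositionSubgroup_comap ht T hT _ hσ

/-- **The infinite-place clause for a totally complex `K`**: `D_w = ⊥` at a complex place (tree
`BigGaloisRep.decompInf_eq_bot_of_isComplex`), so `τ⁻¹ D_w τ ≤ D_w` trivially. [cite: GreenbergLNM1716, §3 p. 87] -/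
theorem exists_conjGalCMH_decompInf_mem [IsTotallyComplex K] (ht : IsLiftOfAut c τ) (w : InfinitePlace K) :
    ∃ (w' : InfinitePlace K) (t : absoluteGaloisGroup K),
      ∀ σ ∈ decompInf w, ht.conjGalCMH σ ∈ MulAut.conj t • decompInf w' := by
  refine ⟨w, 1, fun σ hσ ↦ ?_⟩
  rw [BigGaloisRep.decompInf_eq_bot_of_isComplex (IsTotallyComplex.isComplex w)] at hσ ⊢
  rw [Subgroup.mem_bot] at hσ
  rw [hσ]
  simp only [map_one]
  exact Subgroup.one_mem _

end Places

/-! ## §4 The compatible ring endomorphism of `\bar ℤ_K` for the transport of an element of `Γ_ℚ` -/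

section Transport

/-- **For `τ = e h e⁻¹` the transport of `h ∈ Γ_ℚ` to `K̄`** (`absGaloisTransport`, e.g. the anti-commuting lift of -w2 g8's
`CMPrimes.exists_transport_anticommute`), the map `y ↦ ι(h · ι⁻¹ y)` of the tree's `InertiaLift` bookkeeping is a ring
endomorphism `T` of `\bar ℤ_K` with `(T y : K̄) = τ y` (`InertiaLift.coe_transportIntegers`). ∃-carried, no definition. [folklore] -/
theorem exists_ringHom_coe_eq_absGaloisTransport (h : absoluteGaloisGroup ℚ) :
    ∃ T : absIntegers (𝓞 K) K →+* absIntegers (𝓞 K) K, ∀ y : absIntegers (𝓞 K) K,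
      ((T y : absIntegers (𝓞 K) K) : AlgebraicClosure K) = absGaloisTransport (K := ℚ) (L := K) h (y : AlgebraicClosure K) :=
  ⟨(absIntegersMap ℚ K).comp ((MulSemiringAction.toRingHom (absoluteGaloisGroup ℚ) (absIntegers (𝓞 ℚ) ℚ) h).comp
      (absIntegersEquiv ℚ K).symm.toRingHom), fun y ↦ InertiaLift.coe_transportIntegers h y⟩

/-- The same for the INVERSE lift `τ⁻¹ = e h⁻¹ e⁻¹`: a ring endomorphism `T′` of `\bar ℤ_K` with `(T′ y : K̄) = τ⁻¹ y`
(`(absGaloisTransport h).toRingEquiv.symm = absGaloisTransport h⁻¹` on elements). [folklore] -/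
theorem exists_ringHom_coe_eq_absGaloisTransport_symm (h : absoluteGaloisGroup ℚ) :
    ∃ T' : absIntegers (𝓞 K) K →+* absIntegers (𝓞 K) K, ∀ y : absIntegers (𝓞 K) K,
      ((T' y : absIntegers (𝓞 K) K) : AlgebraicClosure K) =
        (absGaloisTransport (K := ℚ) (L := K) h).toRingEquiv.symm (y : AlgebraicClosure K) := by
  obtain ⟨T', hT'⟩ := exists_ringHom_coe_eq_absGaloisTransport (K := K) h⁻¹
  refine ⟨T', fun y ↦ ?_⟩
  rw [hT', map_inv, AlgEquiv.aut_inv]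
  rfl

end Transport

end Summit.BirchSwinnertonDyer.BirchSwinnertonDyer.Theorems.PrintCf2.ConjTransport

end
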